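import Summits.BirchSwinnertonDyer.BirchSwinnertonDyer.Theorems.ByReductionTypeAtTwoOrdKatoHalfAtTwoIsoZetaColemanMuIotaAdjointTranspose
import Summits.BirchSwinnertonDyer.BirchSwinnertonDyer.Theorems.ByReductionTypeAtTwoOrdKatoHalfAtTwoIsoZetaColemanMuIotaAssembly
import Summits.BirchSwinnertonDyer.BirchSwinnertonDyer.Theorems.ByReductionTypeAtTwoOrdKatoHalfAtTwoIsoPosDiscSplit
import HarnessLib

/-!
# Route ByReductionTypeAtTwo, crux `OrdKatoHalfAtTwoIso` (stmt-BirchSwinnertonDyer-19573), line `steinberg-fibre-at-two`,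
# F1 slot (child stmt-BirchSwinnertonDyer-23959): the local input of F1μι⁻ SHRINKS — no perfect dual pair, no injective
# Coleman map, no ordinary quotient: an ADJOINT pairing that is ONTO the characters, a Coleman map whose KERNEL is
# isotropic to `loc₂(Sel)`, reciprocity on the genuine classes and the explicit-reciprocity shape already give the
# `ι`-keyed reading, `ZetaColemanMuIotaNegDiscAtTwo` BY NAME and the crux BY NAME

Seat `cruxlead-stmt-BirchSwinnertonDyer-19573-w3` g3 (prover WIDTH under the LEAD `cruxlead-19573` g5; HOME
`run/shared/lean/pub/bsd-2adic/`; `--supports` stmt-BirchSwinnertonDyer-23959). THEOREMS ONLY (no definition, no named fact,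
no `sorry`, no instance). HONEST FRAMING (cell bsd-2adic): BSD is not proved by any of this; F1μι⁻, the direct `0 < Δ` child,
B7′ and the crux are NOT proved here; every theorem is a KERNEL implication over explicit hypotheses.

WHY. The honest supply of p693362/p691108 (`hhonest`; its `Δ < 0` restriction `hhonestNeg` in `…IotaAssemblyNegDisc`) asks at
`2`, per datum, for (L′) a PERFECT dual pair `IsDualPair 2 ψ⁻ toDualP` on `(P₀, S)` (bijective `toDualP`, local nilpotence of
`ψ⁻`), an INJECTIVE `col : P₀ → Λ` — in print `P₀ = 𝐇¹_loc ⧸ 𝐇¹_loc(F⁺)`, so the typer must build the ordinary quotient and prove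
Prop. 17.11 at `2` on it — (R) and (E). Reading the proofs shows what the `μ`-chain actually consumes: from the local pair only
the two ADJOINTNESS clauses (`T ↔ ψ⁻`, constants through `ℤ₂ → ℤ/2^k`) — to make the transpose `ι`-semilinear — and
SURJECTIVITY of `toDualP` onto `Hom(S, ℚ/ℤ)` — for the exactness `im τ = ker(X ↠ X₀)`; and from `col` only that its KERNEL pairs
to zero with `φ(Sel)` — so that the transpose factors through `range col ⊆ Λ`. Hence the natural typed objects are the FULL local
Iwasawa cohomology `P₀ = 𝐇¹_{loc,Γ}(T₂W)` (tree: `LocalIwasawaH1Data`), the FULL local `H¹(ℚ_{∞,2}, E[2^∞])` (or any `S`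
receiving `loc₂`), the Λ-adic local Tate pairing (adjoint; onto by Tate duality at the layers — Milne ADT I Cor. 2.3, every
`p`), Kato's Coleman map on `𝐇¹_{loc,Γ}(T)` through `T ↠ T/F⁺T` (kernel `= im 𝐇¹_{loc,Γ}(F⁺T)`, ISOTROPIC to the Kummer
condition by `F⁺ ⊥ F⁺` under the Weil pairing — Greenberg LNM 1716 §2), Poitou–Tate on Kato's classes, and 16.6 (2)/17.12
read on the `Γ`-tower. Strictly fewer and strictly more printed inputs than (L′)+injectivity; the old door factors through the
new one (§5).

* (§1–§2 = the companion `…ZetaColemanMuIotaAdjointTranspose.lean`: the `ι`-semilinear transpose from an ADJOINT source pairing,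
  `exists_involSemilinear_transpose_of_adjoint`.)
* §3 `zetaColemanMuTheta_invol_datum_of_adjointPairing_erl` (+ `_locOne_erl`) — per datum, «F1μ⁺θ» at `θ = ι` from: adjoint
  `toDualP` onto the characters, `col` with `ker col ⊥ φ(Sel)`, `φ = loc₂` (intertwining, kernel clause), (R) on `G`, (E).
  `P := range col`, `ℓ := col ∘ ℓ₀`, `τ :=` the transpose DESCENDED along `P₀ ↠ P₀ ⧸ ker col ≅ range col` (`Submodule.liftQ`,
  `LinearMap.quotKerEquivRange`), `π` the canonical fine quotient.
* §4 ∀-supplies: `hweakNeg` (the §3 hypotheses for every datum on the cell `Δ < 0`) ⇒ `ZetaColemanMuIotaNegDiscAtTwo` BY NAME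
  (lead's def, p693557) ⇒ the crux BY NAME through `ordKatoHalfAtTwoIso_of_iota_halves` (P8′ shape; `μ = 0` and Kato's `μ`-part follow by the lead's
  `mu_eq_zero_of_iotaNegDisc` / `katoMuPartAtTwo_of_iotaNegDisc`).
* §5 the perfect-pair/injective-`col` hypotheses of p693362 imply the weak ones (so nothing is lost).

References: [Kato2004Asterisque] Thm 12.6 (p. 222), (14.9.3) (p. 240), Thm 16.6 (2) (p. 271), Thm 17.4 (1)(2) (p. 273), Lemma 17.9,
Prop 17.11, Lemma 17.12 (pp. 275–279), §17.13 (pp. 279–280); [MilneADT2006] I Cor. 2.3, I Thm 4.10; [GreenbergLNM1716] §1 p. 60, §2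
(pp. 69–74), Prop 5.14; [Lang1990] Ch. 5 §1; [MazurTateTeitelbaum1986Invent] Ch. I §17; [AbbesUllmo1996] Thm A; tree p682177,
p688256, p690240, p691108, p693362, p693557, `…PosDiscSplit` (lead g5).
-/

set_option autoImplicit false
set_option linter.dupNamespace false

noncomputable section

open scoped Classical MatrixGroups ModularForm NumberField
open CongruenceSubgroup WeierstrassCurve Field IsDedekindDomain NumberField
open Literature.NumberTheory.GaloisRepresentations
open Literature.NumberTheory.GaloisCohomology
open Literature.NumberTheory.EllipticCurves Literature.NumberTheory.EllipticCurves.ModularForms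
  Literature.NumberTheory.EllipticCurves.GreenbergSelmer
open Literature.NumberTheory.EllipticCurves.Kato2004
  Literature.NumberTheory.EllipticCurves.Kato2004.EulerSystemValues
open Literature.NumberTheory.EllipticCurves.IwasawaDual
open Literature.NumberTheory.EllipticCurves.Rank1Residual
open Literature.NumberTheory.EllipticCurves.Greenberg1999
open Summit.BirchSwinnertonDyer.Rank1Residual Summit.BirchSwinnertonDyer.Rank1Residual.X5
open Summit.BirchSwinnertonDyer.BirchSwinnertonDyer.Theorems.OrdKatoOptimalAtTwo
  Summit.BirchSwinnertonDyer.BirchSwinnertonDyer.Theorems.OrdKatoIntAtTwo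
open Summit.BirchSwinnertonDyer.BirchSwinnertonDyer.Theses.ByReductionTypeAtTwo

namespace Summit.BirchSwinnertonDyer.BirchSwinnertonDyer.Theorems.SteinbergFibreAtTwo

/-! ## §3 Per datum: «F1μ⁺θ» at `θ = ι` from an adjoint pairing ONTO the characters and a Coleman map ISOTROPIC to `loc₂(Sel)` -/

section PerDatum

variable {W : WeierstrassCurve ℚ} [W.IsElliptic] [W.IsGloballyMinimal]
  [ContinuousSMul ℤ_[2] (W.tateModule 2)] [Module.Free ℤ_[2] (W.tateModule 2)]
  [Module.Finite ℤ_[2] (W.tateModule 2)] {N : ℕ} {f : CuspForm (Gamma0 N) 2}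
  {κ : ZpExtension ℚ 2} {γ : absoluteGaloisGroup ℚ} {hκ : κ.IsCyclotomic}

/-- **«F1μ⁺θ» at `θ = ι`, per datum, from the WEAK local inputs at `2`.** Data/hypotheses (explicit; nothing asserted): the
pinned `𝐇¹` `I`, a SET `G ⊆ 𝐇¹` of GENUINE `2`-adic Euler-system classes; a `Λ`-module `P₀` (print: the FULL local Iwasawa
cohomology `𝐇¹_{loc,Γ}(T₂W)`), an abelian group `S` (print: `H¹(ℚ_{∞,2}, E[2^∞])` or the local Kummer group) with two
endomorphisms `ψ⁻, ψ` inverse to each other in the sense `(1+ψ⁻)(1+ψ) = 1 = (1+ψ)(1+ψ⁻)` (print: `conj_{γᵥ}^{∓1} − 1`), an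
ADJOINT pairing `toDualP : P₀ → Hom(S, ℚ/ℤ)` (`T ↔ ψ⁻`, constants through `ℤ₂ → ℤ/2^k`; print: the Λ-adic local Tate pairing,
equivariance (P2)) which is ONTO (print: Tate local duality at the layers); a `Λ`-linear `col : P₀ → Λ` whose KERNEL pairs to
zero with `φ(Sel)` (print: Kato's `𝔏_η ∘ (T ↠ T/F⁺T)` on the `Γ`-tower, kernel `im 𝐇¹_{loc,Γ}(F⁺T)`, isotropic to the Kummer
condition); `φ : Sel → S` intertwining `conj_γ − 1` with `ψ` whose kernel is «restriction to every decomposition group above `2`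
vanishes» (`loc₂`); (R) `toDualP (ℓ₀ g) (φ s) = 0` for `g ∈ G` (Poitou–Tate); (E) the ERL shape `col (ℓ₀ g) = u·M·L′`, `M ∉ (2)`,
`ι L′ = C r · L₂(f, α)`, `‖r‖₂ = 1`. CONCLUSION: the per-datum package of the `ι`-keyed reading (`Z := Λ·G`, `P := range col`,
`ℓ := col ∘ ℓ₀`, `τ` the `ι`-semilinear transpose of `φ` DESCENDED to `P₀ ⧸ ker col ≅ range col`, `π` the canonical fine quotient).
[cite: Kato2004Asterisque, Thm 12.6 (p. 222), (14.9.3) (p. 240), Thm 16.6 (2) (p. 271), Lemma 17.9, Prop 17.11, Lemma 17.12 (pp. 275–279), §17.13 (pp. 279–280)]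
[cite: MilneADT2006, Ch. I, Cor. 2.3] [cite: GreenbergLNM1716, §2 (pp. 69–74)] -/
theorem zetaColemanMuTheta_invol_datum_of_adjointPairing_erl (D : W.SelmerDualData κ γ)
    (Y : W.FineSelmerDualData κ γ) (I : IwasawaH1Data W 2 κ γ) (G : Set I.H)
    (hG : ∀ g ∈ G, IsEulerSystemClassTwo W hκ I g)
    {P₀ : Type*} [AddCommGroup P₀] [Module (IwasawaAlgebra 2) P₀] {S : Type*} [AddCommGroup S]
    (ψm ψ : AddMonoid.End S) (hψ₁ : (1 + ψm) * (1 + ψ) = 1) (hψ₂ : (1 + ψ) * (1 + ψm) = 1)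
    (toDualP : P₀ →+ (S →+ AddCircle (1 : ℚ)))
    (hT : ∀ (x : P₀) (s : S), toDualP ((PowerSeries.X : IwasawaAlgebra 2) • x) s = toDualP x (ψm s))
    (hC : ∀ (c : ℤ_[2]) (x : P₀) (s : S) (k : ℕ), 2 ^ k • s = 0 →
      toDualP (PowerSeries.C c • x) s = (PadicInt.toZModPow k c).val • toDualP x s)
    (hsurj : Function.Surjective toDualP)
    (col : P₀ →ₗ[IwasawaAlgebra 2] IwasawaAlgebra 2)
    (φ : W.selmerInfty κ →+ S) (hφ : ∀ s, φ ((W.conjSelmerInfty κ γ - 1) s) = ψ (φ s))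
    (hφker : ∀ s : W.selmerInfty κ, φ s = 0 ↔
      ∀ (v : HeightOneSpectrum (𝓞 ℚ)), ((2 : ℕ) : 𝓞 ℚ) ∈ v.asIdeal → ∀ σ : absoluteGaloisGroup ℚ,
        W.conjH1 2 κ.kerSubgroup σ (s : W.subgroupH1 2 κ.kerSubgroup) ∈
          awayKer κ.kerSubgroup (W.geomPrimaryTorsion 2) v)
    (hcolφ : ∀ x : P₀, col x = 0 → ∀ s : W.selmerInfty κ, toDualP x (φ s) = 0)
    (ℓ₀ : I.H →ₗ[IwasawaAlgebra 2] P₀)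
    (hrecG : ∀ g ∈ G, ∀ s : W.selmerInfty κ, toDualP (ℓ₀ g) (φ s) = 0)
    (herl : ∃ g ∈ G, ∃ (u : (IwasawaAlgebra 2)ˣ) (M L' : IwasawaAlgebra 2) (r : ℚ_[2]),
      M ∉ IwasawaAlgebra.augIdealP 2 ∧ ‖r‖ = 1 ∧
        iwasawaToPowerSeries 2 L' = PowerSeries.C r * padicLFunction f (unitRoot W 2 : ℚ_[2]) ∧
        col (ℓ₀ g) = (u : IwasawaAlgebra 2) * M * L') :
    ∃ (Z : Submodule (IwasawaAlgebra 2) I.H) (P : Submodule (IwasawaAlgebra 2) (IwasawaAlgebra 2))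
      (ℓ : I.H →ₗ[IwasawaAlgebra 2] P)
      (τ : P →ₛₗ[((IwasawaAlgebra.involEquiv 2).toRingEquiv : IwasawaAlgebra 2 →+* IwasawaAlgebra 2)] D.X)
      (π : D.X →ₗ[IwasawaAlgebra 2] Y.X),
      Z ≤ Submodule.span (IwasawaAlgebra 2) {s : I.H | IsEulerSystemClassTwo W hκ I s} ∧
      (∀ z ∈ Z, τ (ℓ z) = 0) ∧ Function.Surjective π ∧ Function.Exact τ π ∧
      ∀ G₁ : IwasawaAlgebra 2,
        iwasawaToPowerSeries 2 G₁ = padicLFunction f (unitRoot W 2 : ℚ_[2]) →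
          ∃ s : IwasawaAlgebra 2, s ∉ IwasawaAlgebra.augIdealP 2 ∧
            s * G₁ ∈ Submodule.map (P.subtype ∘ₗ ℓ) Z := by
  -- the `ι`-semilinear transpose `F : P₀ → X` of `φ = loc₂`, and the canonical fine quotient `π`
  obtain ⟨F, hF⟩ := exists_involSemilinear_transpose_of_adjoint hT hC (D.isDualPair' W κ) ψ hψ₁ hψ₂ φ hφ
  obtain ⟨π, hπs, hπ⟩ := WeierstrassCurve.FineSelmerDualData.exists_linearMap_ofSelmerDual W κ D Y
  have hker' : ∀ s : W.selmerInfty κ,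
      φ s = 0 ↔ s ∈ (AddSubgroup.inclusion (W.fineSelmerInfty_le_selmerInfty κ)).range := by
    intro s
    rw [hker_of_kernel_above_two φ hφker, AddMonoidHom.mem_range]
    constructor
    · intro hs
      exact ⟨⟨(s : W.subgroupH1 2 κ.kerSubgroup), hs⟩, Subtype.ext rfl⟩
    · rintro ⟨s₀, rfl⟩
      exact s₀.2
  have hexact : Function.Exact F π :=
    exact_transpose_of_ker_eq_range D.bijective Y.bijective.1 hsurj
      (AddSubgroup.inclusion (W.fineSelmerInfty_le_selmerInfty κ)) φ hker' hπ hF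
  -- reciprocity on `G` propagates to `Z := Λ·G`
  have hZ0 : ∀ z ∈ Submodule.span (IwasawaAlgebra 2) G, F (ℓ₀ z) = 0 := by
    have hle : Submodule.span (IwasawaAlgebra 2) G ≤ (LinearMap.ker F).comap ℓ₀ := by
      rw [Submodule.span_le]
      intro g hg
      rw [SetLike.mem_coe, Submodule.mem_comap, LinearMap.mem_ker]
      exact transpose_eq_zero_of_pairing_eq_zero D.bijective.1 φ hF (hrecG g hg)
    intro z hz
    have := hle hz
    rwa [Submodule.mem_comap, LinearMap.mem_ker] at this
  -- the transpose descends along `P₀ ↠ P₀ ⧸ ker col ≅ range col` (isotropy of `ker col`)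
  have hkerle : LinearMap.ker col ≤ LinearMap.ker F := by
    intro x hx
    rw [LinearMap.mem_ker] at hx ⊢
    exact transpose_eq_zero_of_pairing_eq_zero D.bijective.1 φ hF (hcolφ x hx)
  let τ : LinearMap.range col →ₛₗ[((IwasawaAlgebra.involEquiv 2).toRingEquiv :
      IwasawaAlgebra 2 →+* IwasawaAlgebra 2)] D.X :=
    ((LinearMap.ker col).liftQ F hkerle).comp col.quotKerEquivRange.symm.toLinearMap
  have hτ : ∀ x : P₀, τ (col.rangeRestrict x) = F x := by
    intro x
    change (LinearMap.ker col).liftQ F hkerle (col.quotKerEquivRange.symm ⟨col x, LinearMap.mem_range_self col x⟩) = F x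
    rw [LinearMap.quotKerEquivRange_symm_apply_image, Submodule.mkQ_apply, Submodule.liftQ_apply]
  refine ⟨Submodule.span (IwasawaAlgebra 2) G, LinearMap.range col, col.rangeRestrict ∘ₗ ℓ₀, τ, π,
    Submodule.span_mono fun g hg => hG g hg, ?_, hπs, ?_, ?_⟩
  · -- (b) `τ (ℓ z) = 0` on `Z`
    intro z hz
    change τ (col.rangeRestrict (ℓ₀ z)) = 0
    rw [hτ]
    exact hZ0 z hz
  · -- (d) exactness at `X`: `range τ = range F`
    intro x
    refine (hexact x).trans ⟨?_, ?_⟩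
    · rintro ⟨u, hu⟩
      exact ⟨col.rangeRestrict u, by rw [hτ]; exact hu⟩
    · rintro ⟨v, hv⟩
      obtain ⟨u, hu⟩ := col.surjective_rangeRestrict v
      exact ⟨u, by rw [← hτ, hu]; exact hv⟩
  · -- (e) the image clause, transported to `range col`, from the ERL shape
    intro G₁ hG₁
    obtain ⟨g, hg, s, hs, hsG⟩ := himgG_of_erlShape G col ℓ₀ herl G₁ hG₁
    refine ⟨s, hs, ⟨g, Submodule.subset_span hg, ?_⟩⟩
    rw [← hsG]
    rfl

/-- **The same, with `φ = loc₂` given by its kernel at ONE place above `2`** (p690240 `hφker_of_kernel_at_one_place_two`: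
`ℚ_∞/ℚ` is undecomposed at `2`). Kernel; nothing asserted.
[cite: Kato2004Asterisque, (14.9.3) (p. 240), Prop 17.11 (p. 277), §17.13 (pp. 279–280)] [cite: GreenbergLNM1716, §2 (p. 72)] -/
theorem zetaColemanMuTheta_invol_datum_of_adjointPairing_locOne_erl (D : W.SelmerDualData κ γ)
    (Y : W.FineSelmerDualData κ γ) (I : IwasawaH1Data W 2 κ γ) (G : Set I.H)
    (hG : ∀ g ∈ G, IsEulerSystemClassTwo W hκ I g)
    (v₂ : HeightOneSpectrum (𝓞 ℚ)) (hv₂ : ((2 : ℕ) : 𝓞 ℚ) ∈ v₂.asIdeal)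
    {P₀ : Type*} [AddCommGroup P₀] [Module (IwasawaAlgebra 2) P₀] {S : Type*} [AddCommGroup S]
    (ψm ψ : AddMonoid.End S) (hψ₁ : (1 + ψm) * (1 + ψ) = 1) (hψ₂ : (1 + ψ) * (1 + ψm) = 1)
    (toDualP : P₀ →+ (S →+ AddCircle (1 : ℚ)))
    (hT : ∀ (x : P₀) (s : S), toDualP ((PowerSeries.X : IwasawaAlgebra 2) • x) s = toDualP x (ψm s))
    (hC : ∀ (c : ℤ_[2]) (x : P₀) (s : S) (k : ℕ), 2 ^ k • s = 0 →
      toDualP (PowerSeries.C c • x) s = (PadicInt.toZModPow k c).val • toDualP x s)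
    (hsurj : Function.Surjective toDualP)
    (col : P₀ →ₗ[IwasawaAlgebra 2] IwasawaAlgebra 2)
    (φ : W.selmerInfty κ →+ S) (hφ : ∀ s, φ ((W.conjSelmerInfty κ γ - 1) s) = ψ (φ s))
    (hφ₁ : ∀ s : W.selmerInfty κ, φ s = 0 ↔
      W.resOfLe 2 (inf_le_left : κ.kerSubgroup ⊓ decomp v₂ ≤ κ.kerSubgroup)
        (s : W.subgroupH1 2 κ.kerSubgroup) = 0)
    (hcolφ : ∀ x : P₀, col x = 0 → ∀ s : W.selmerInfty κ, toDualP x (φ s) = 0)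
    (ℓ₀ : I.H →ₗ[IwasawaAlgebra 2] P₀)
    (hrecG : ∀ g ∈ G, ∀ s : W.selmerInfty κ, toDualP (ℓ₀ g) (φ s) = 0)
    (herl : ∃ g ∈ G, ∃ (u : (IwasawaAlgebra 2)ˣ) (M L' : IwasawaAlgebra 2) (r : ℚ_[2]),
      M ∉ IwasawaAlgebra.augIdealP 2 ∧ ‖r‖ = 1 ∧
        iwasawaToPowerSeries 2 L' = PowerSeries.C r * padicLFunction f (unitRoot W 2 : ℚ_[2]) ∧
        col (ℓ₀ g) = (u : IwasawaAlgebra 2) * M * L') :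
    ∃ (Z : Submodule (IwasawaAlgebra 2) I.H) (P : Submodule (IwasawaAlgebra 2) (IwasawaAlgebra 2))
      (ℓ : I.H →ₗ[IwasawaAlgebra 2] P)
      (τ : P →ₛₗ[((IwasawaAlgebra.involEquiv 2).toRingEquiv : IwasawaAlgebra 2 →+* IwasawaAlgebra 2)] D.X)
      (π : D.X →ₗ[IwasawaAlgebra 2] Y.X),
      Z ≤ Submodule.span (IwasawaAlgebra 2) {s : I.H | IsEulerSystemClassTwo W hκ I s} ∧
      (∀ z ∈ Z, τ (ℓ z) = 0) ∧ Function.Surjective π ∧ Function.Exact τ π ∧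
      ∀ G₁ : IwasawaAlgebra 2,
        iwasawaToPowerSeries 2 G₁ = padicLFunction f (unitRoot W 2 : ℚ_[2]) →
          ∃ s : IwasawaAlgebra 2, s ∉ IwasawaAlgebra.augIdealP 2 ∧
            s * G₁ ∈ Submodule.map (P.subtype ∘ₗ ℓ) Z :=
  zetaColemanMuTheta_invol_datum_of_adjointPairing_erl D Y I G hG ψm ψ hψ₁ hψ₂ toDualP hT hC hsurj col φ hφ
    (hφker_of_kernel_at_one_place_two hκ v₂ hv₂ φ hφ₁) hcolφ ℓ₀ hrecG herl

end PerDatum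

/-! ## §4 The WEAK ∀-supply on the `Δ < 0` cell ⇒ F1μι⁻ BY NAME ⇒ the crux BY NAME -/

section WeakNeg

-- The WEAK ∀-supply `hweakNeg` RESTRICTED TO `Δ < 0` (sign binder first; Selmer-side objects before the local module) is the
-- explicit first hypothesis of each theorem below: a hypothesis (the typed inputs at `2`), not a definition.
/-- **The weak `Δ < 0` supply gives F1μι⁻ = `ZetaColemanMuIotaNegDiscAtTwo` BY NAME** (the lead's displayed text, p693557; the
P8′ F1 conjunct), per datum by `zetaColemanMuTheta_invol_datum_of_adjointPairing_locOne_erl`. Kernel; the supply is the OPEN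
content; nothing asserted. [cite: Kato2004Asterisque, Thm 12.6 (p. 222), (14.9.3) (p. 240), Thm 16.6 (2) (p. 271), Prop 17.11, Lemma 17.12 (pp. 277–279), §17.13 (pp. 279–280)]
[cite: MilneADT2006, Ch. I, Cor. 2.3] [cite: GreenbergLNM1716, §2 (pp. 69–74)] -/
theorem zetaColemanMuIotaNegDiscAtTwo_of_adjointPairings_negDisc
    (hweakNeg : ∀ (W : WeierstrassCurve ℚ) [W.IsElliptic] [W.IsGloballyMinimal]
    [ContinuousSMul ℤ_[2] (W.tateModule 2)] [Module.Free ℤ_[2] (W.tateModule 2)]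
    [Module.Finite ℤ_[2] (W.tateModule 2)] {N : ℕ} [NeZero N] (f : CuspForm (Gamma0 N) 2)
    (κ : ZpExtension ℚ 2) (γ : absoluteGaloisGroup ℚ) (hκ : κ.IsCyclotomic),
    W.Δ < 0 → IsOrdinaryAt W 2 → W.HasSurjectiveModNGaloisRep 2 →
    κ.IsTopGenerator γ → IsCyclotomicVariable 2 γ → IsNewformOf W f →
    ∀ (D : W.SelmerDualData κ γ),
      ∃ (I : IwasawaH1Data W 2 κ γ) (G : Set I.H)
        (v₂ : HeightOneSpectrum (𝓞 ℚ)) (_ : ((2 : ℕ) : 𝓞 ℚ) ∈ v₂.asIdeal)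
        (S : Type) (_ : AddCommGroup S) (ψm ψ : AddMonoid.End S) (φ : W.selmerInfty κ →+ S)
        (P₀ : Type) (_ : AddCommGroup P₀) (_ : Module (IwasawaAlgebra 2) P₀)
        (toDualP : P₀ →+ (S →+ AddCircle (1 : ℚ)))
        (col : P₀ →ₗ[IwasawaAlgebra 2] IwasawaAlgebra 2) (ℓ₀ : I.H →ₗ[IwasawaAlgebra 2] P₀),
        (∀ g ∈ G, IsEulerSystemClassTwo W hκ I g) ∧
        (1 + ψm) * (1 + ψ) = 1 ∧ (1 + ψ) * (1 + ψm) = 1 ∧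
        (∀ s, φ ((W.conjSelmerInfty κ γ - 1) s) = ψ (φ s)) ∧
        (∀ s : W.selmerInfty κ, φ s = 0 ↔
          W.resOfLe 2 (inf_le_left : κ.kerSubgroup ⊓ decomp v₂ ≤ κ.kerSubgroup)
            (s : W.subgroupH1 2 κ.kerSubgroup) = 0) ∧
        (∀ (x : P₀) (s : S), toDualP ((PowerSeries.X : IwasawaAlgebra 2) • x) s = toDualP x (ψm s)) ∧
        (∀ (c : ℤ_[2]) (x : P₀) (s : S) (k : ℕ), 2 ^ k • s = 0 →
          toDualP (PowerSeries.C c • x) s = (PadicInt.toZModPow k c).val • toDualP x s) ∧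
        Function.Surjective toDualP ∧
        (∀ x : P₀, col x = 0 → ∀ s : W.selmerInfty κ, toDualP x (φ s) = 0) ∧
        (∀ g ∈ G, ∀ s : W.selmerInfty κ, toDualP (ℓ₀ g) (φ s) = 0) ∧
        ∃ g ∈ G, ∃ (u : (IwasawaAlgebra 2)ˣ) (M L' : IwasawaAlgebra 2) (r : ℚ_[2]),
          M ∉ IwasawaAlgebra.augIdealP 2 ∧ ‖r‖ = 1 ∧
            iwasawaToPowerSeries 2 L' = PowerSeries.C r * padicLFunction f (unitRoot W 2 : ℚ_[2]) ∧
            col (ℓ₀ g) = (u : IwasawaAlgebra 2) * M * L') :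
    ZetaColemanMuIotaNegDiscAtTwo := by
  intro W _ _ _ _ _ N _ f κ γ hκ hord h2 hΔ hγ hγ' hf D Y
  obtain ⟨I, G, v₂, hv₂, S, instS, ψm, ψ, φ, P₀, instP₀, instP₀', toDualP, col, ℓ₀, hG, hψ₁, hψ₂, hφ, hφ₁, hT, hC, hsurj,
    hcolφ, hrecG, herl⟩ := hweakNeg W f κ γ hκ hΔ hord h2 hγ hγ' hf D
  obtain ⟨Z, P, ℓ, τ, π, h⟩ := zetaColemanMuTheta_invol_datum_of_adjointPairing_locOne_erl D Y I G hG v₂ hv₂ ψm ψ hψ₁ hψ₂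
    toDualP hT hC hsurj col φ hφ hφ₁ hcolφ ℓ₀ hrecG herl
  exact ⟨I, Z, P, ℓ, τ, π, h⟩

/-- **The crux `OrdKatoHalfAtTwoIso` (stmt-BirchSwinnertonDyer-19573) BY NAME in the P8′ split-glue shape, with the F1 conjunct
supplied by the WEAK `Δ < 0` inputs**: `hweakNeg`, the direct `0 < Δ` child `OrdKatoHalfAtTwoIsoPosDisc`, the print bundle
`PUB ∧ Abbes–Ullmo ∧ Greenberg 5.14@2` (child 23889) and B7′ (child 23921) — through the lead's `ordKatoHalfAtTwoIso_of_iota_halves`.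
CONDITIONAL on the displayed hypotheses; nothing closed. [cite: Kato2004Asterisque, Thm. 17.4 (1)(2) (p. 273)]
[cite: GreenbergLNM1716, Prop. 5.14 (p. 130)] [cite: AbbesUllmo1996, Thm. A] -/
theorem ordKatoHalfAtTwoIso_of_adjointPairings_negDisc_halves
    (hweakNeg : ∀ (W : WeierstrassCurve ℚ) [W.IsElliptic] [W.IsGloballyMinimal]
    [ContinuousSMul ℤ_[2] (W.tateModule 2)] [Module.Free ℤ_[2] (W.tateModule 2)]
    [Module.Finite ℤ_[2] (W.tateModule 2)] {N : ℕ} [NeZero N] (f : CuspForm (Gamma0 N) 2)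
    (κ : ZpExtension ℚ 2) (γ : absoluteGaloisGroup ℚ) (hκ : κ.IsCyclotomic),
    W.Δ < 0 → IsOrdinaryAt W 2 → W.HasSurjectiveModNGaloisRep 2 →
    κ.IsTopGenerator γ → IsCyclotomicVariable 2 γ → IsNewformOf W f →
    ∀ (D : W.SelmerDualData κ γ),
      ∃ (I : IwasawaH1Data W 2 κ γ) (G : Set I.H)
        (v₂ : HeightOneSpectrum (𝓞 ℚ)) (_ : ((2 : ℕ) : 𝓞 ℚ) ∈ v₂.asIdeal)
        (S : Type) (_ : AddCommGroup S) (ψm ψ : AddMonoid.End S) (φ : W.selmerInfty κ →+ S)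
        (P₀ : Type) (_ : AddCommGroup P₀) (_ : Module (IwasawaAlgebra 2) P₀)
        (toDualP : P₀ →+ (S →+ AddCircle (1 : ℚ)))
        (col : P₀ →ₗ[IwasawaAlgebra 2] IwasawaAlgebra 2) (ℓ₀ : I.H →ₗ[IwasawaAlgebra 2] P₀),
        (∀ g ∈ G, IsEulerSystemClassTwo W hκ I g) ∧
        (1 + ψm) * (1 + ψ) = 1 ∧ (1 + ψ) * (1 + ψm) = 1 ∧
        (∀ s, φ ((W.conjSelmerInfty κ γ - 1) s) = ψ (φ s)) ∧
        (∀ s : W.selmerInfty κ, φ s = 0 ↔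
          W.resOfLe 2 (inf_le_left : κ.kerSubgroup ⊓ decomp v₂ ≤ κ.kerSubgroup)
            (s : W.subgroupH1 2 κ.kerSubgroup) = 0) ∧
        (∀ (x : P₀) (s : S), toDualP ((PowerSeries.X : IwasawaAlgebra 2) • x) s = toDualP x (ψm s)) ∧
        (∀ (c : ℤ_[2]) (x : P₀) (s : S) (k : ℕ), 2 ^ k • s = 0 →
          toDualP (PowerSeries.C c • x) s = (PadicInt.toZModPow k c).val • toDualP x s) ∧
        Function.Surjective toDualP ∧
        (∀ x : P₀, col x = 0 → ∀ s : W.selmerInfty κ, toDualP x (φ s) = 0) ∧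
        (∀ g ∈ G, ∀ s : W.selmerInfty κ, toDualP (ℓ₀ g) (φ s) = 0) ∧
        ∃ g ∈ G, ∃ (u : (IwasawaAlgebra 2)ˣ) (M L' : IwasawaAlgebra 2) (r : ℚ_[2]),
          M ∉ IwasawaAlgebra.augIdealP 2 ∧ ‖r‖ = 1 ∧
            iwasawaToPowerSeries 2 L' = PowerSeries.C r * padicLFunction f (unitRoot W 2 : ℚ_[2]) ∧
            col (ℓ₀ g) = (u : IwasawaAlgebra 2) * M * L')
    (hPos : OrdKatoHalfAtTwoIsoPosDisc)
    (hbundle : OrdPublishedInputsAtTwo ∧ abbesUllmo_not_dvd_maninConstant_of_not_dvd_level ∧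
      Greenberg1999.prop514_isTorsion_mu_eq_zero_two)
    (hB7' : KatoMuPartOff514AtOptimalMemberOfNotSurjectiveTwo) : OrdKatoHalfAtTwoIso :=
  ordKatoHalfAtTwoIso_of_iota_halves (zetaColemanMuIotaNegDiscAtTwo_of_adjointPairings_negDisc hweakNeg)
    hPos hbundle hB7'

end WeakNeg

/-! ## §5 Nothing is lost: the perfect-pair / injective-`col` inputs of p693362 are weak inputs -/

/-- **A perfect dual pair with an injective Coleman map is an adjoint pairing onto the characters with an isotropic-kernel Coleman
map** — the per-datum hypotheses (L′) of p691108/p693362 imply those of §3 (so the honest doors factor through the weak ones).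
[cite: GreenbergLNM1716, §1 p. 60 (the Pontryagin dual as a Λ-module)] -/
theorem adjointPairing_hypotheses_of_isDualPair_of_injective
    {P₀ : Type*} [AddCommGroup P₀] [Module (IwasawaAlgebra 2) P₀] {S : Type*} [AddCommGroup S]
    {ψm : AddMonoid.End S} {toDualP : P₀ →+ (S →+ AddCircle (1 : ℚ))} (hP : IsDualPair 2 ψm toDualP)
    (col : P₀ →ₗ[IwasawaAlgebra 2] IwasawaAlgebra 2) (hcol : Function.Injective col)
    {Sel : Type*} (φ : Sel → S) :
    (∀ (x : P₀) (s : S), toDualP ((PowerSeries.X : IwasawaAlgebra 2) • x) s = toDualP x (ψm s)) ∧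
    (∀ (c : ℤ_[2]) (x : P₀) (s : S) (k : ℕ), 2 ^ k • s = 0 →
      toDualP (PowerSeries.C c • x) s = (PadicInt.toZModPow k c).val • toDualP x s) ∧
    Function.Surjective toDualP ∧
    (∀ x : P₀, col x = 0 → ∀ s : Sel, toDualP x (φ s) = 0) := by
  refine ⟨hP.T_smul, hP.C_smul, hP.bijective.2, fun x hx s => ?_⟩
  have hx0 : x = 0 := hcol (by rw [hx, map_zero])
  rw [hx0, map_zero, AddMonoidHom.zero_apply]

end Summit.BirchSwinnertonDyer.BirchSwinnertonDyer.Theorems.SteinbergFibreAtTwo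

end
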